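import Summits.KontsevichZagierPeriods.KontsevichZagierPeriods.Theorems.SymplecticScissorsVolumeFormOffPlaneTwoPeriods
import Summits.KontsevichZagierPeriods.KontsevichZagierPeriods.Theorems.SymplecticScissorsVolumeFormOffPlaneLogBoxCut
import Summits.KontsevichZagierPeriods.KontsevichZagierPeriods.Theorems.SymplecticScissorsVolumeFormOffPlaneLogBoxValue
import Summits.KontsevichZagierPeriods.KontsevichZagierPeriods.Theorems.HyperbolicBlochOffTetraSectorKernelStubHermiteLindemannRing

/-!
# `VolumeFormOffPlane` (stmt-KontsevichZagierPeriods-14935) — line `Sketch`, v7: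
TWO PERIODS, toric instance — K-cells ⊕ the affine orbit of the isotropic log-box (Hermite–Lindemann)

The mixing theorem `pointCellOrbitPairs` of the line (file `…TwoPeriods.lean`) takes ANY body of
transcendental volume. Besides the balls (Lindemann), the line's own toric cells qualify: the
isotropic log-box `L_α = {1 < xᵢ < α (i < n), 0 < z, z·∏ xᵢ < 1} ⊆ ℝⁿ⁺¹` has volume `(log α)ⁿ`
(`stub_logBoxValue`, lead 0), transcendental for real algebraic `α > 1` and `n ≥ 1` by the
Hermite–Lindemann theorem PROVED in the tree (`hermiteLindemann_transcendental_log`, from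
`transcendental_exp_holds`). Hence `pointCellLogBoxPairs`: a.e. `ℤ`-combinations of K-cells
(algebraic boxes, simplices, polynomial subgraphs, …) AND of real-algebraic affine images of
`L_α`, with equal volume, are KZ-equivalent — the toric and the Euclidean sectors of the line meet
in one domain (period types `1` and `(log α)ⁿ`).

Sources: Kontsevich–Zagier 2001, §1.2; Ch. Hermite (1873), F. Lindemann (1882); folklore.
-/

noncomputable section

open MeasureTheory Set
open Literature.NumberTheory.Transcendental
open Literature.ModelTheory.ExponentialFields (IsSemialgebraic)

namespace Summit.KontsevichZagierPeriods.SymplecticScissors.LogPolytope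

/-- The isotropic log-box `L_α ⊆ ℝⁿ⁺¹` has volume `(log α)ⁿ` (`lbv_volume_logBox`; `α` real
algebraic only to quote the line's semialgebraicity lemma for measurability). [folklore] -/
theorem tplb_volume_logBox (n : ℕ) {α : ℝ} (hα : 1 < α) (halg : IsAlgebraic ℚ α) :
    volume {p : Fin (n + 1) → ℝ | (∀ j : Fin n, (fun _ => (1 : ℝ)) j < p (Fin.castSucc j) ∧
      p (Fin.castSucc j) < (fun _ => α) j) ∧ 0 < p (Fin.last n) ∧
      p (Fin.last n) * ∏ j : Fin n, p (Fin.castSucc j) < 1} = ENNReal.ofReal (Real.log α ^ n) := by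
  rw [lbv_volume_logBox (fun _ => (1 : ℝ)) (fun _ => α) (fun _ => one_pos) (fun _ => hα) _
    (Literature.ModelTheory.ExponentialFields.IsSemialgebraic.measurableSet_holds
      (lbc_isSemialgebraic_logBox (fun _ => (isAlgebraic_one : IsAlgebraic ℚ (1 : ℝ)))
        (fun _ => halg))) rfl]
  simp

/-- **The isotropic log-box has transcendental volume** (`n ≥ 1`, `α > 1` real algebraic):
`(log α)ⁿ ∉ ℚ̄` by Hermite–Lindemann. [Lindemann 1882] [folklore] -/
theorem tplb_transcendental_volume_logBox (n : ℕ) (hn : 1 ≤ n) {α : ℝ} (hα : 1 < α)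
    (halg : IsAlgebraic ℚ α) :
    Transcendental ℚ (volume {p : Fin (n + 1) → ℝ | (∀ j : Fin n, (fun _ => (1 : ℝ)) j <
      p (Fin.castSucc j) ∧ p (Fin.castSucc j) < (fun _ => α) j) ∧ 0 < p (Fin.last n) ∧
      p (Fin.last n) * ∏ j : Fin n, p (Fin.castSucc j) < 1}).toReal := by
  rw [tplb_volume_logBox n hα halg, ENNReal.toReal_ofReal (pow_nonneg (Real.log_pos hα).le n)]
  exact (Summit.KontsevichZagierPeriods.HyperbolicBloch.OffTetraSectorKernel.hermiteLindemann_transcendental_log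
    halg hα).pow (by omega)

/-- **POINT-CELL ⊕ LOG-BOX PAIRS (dimension `n + 1 ≥ 2`; the toric and Euclidean sectors in one
domain).** Fix a real algebraic `α > 1` and `n ≥ 1`. Two integrand-`1` representations of
dimension `n + 1` whose domains are, almost everywhere, `ℤ`-combinations of indicators of K-cells
(certificates `[ρ] − [pt, v] ∈ relations`, `v ∈ ℚ̄`) AND of real-algebraic affine images
`A L_α + b` of the isotropic log-box `L_α = {1 < xᵢ < α, 0 < z, z ∏ xᵢ < 1}` (`det A ≠ 0`), and
whose values agree, are KZ-equivalent: `pointCellOrbitPairs` for the body `L_α`, of volume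
`(log α)ⁿ`, transcendental by Hermite–Lindemann (proved in the tree).
[Lindemann 1882; Kontsevich–Zagier 2001, §1.2] [folklore] -/
theorem pointCellLogBoxPairs :
    ∀ (n : ℕ), 1 ≤ n → ∀ (α : ℝ), 1 < α → IsAlgebraic ℚ α →
      ∀ (r r' : KZ.IntegralRep (n + 1)) (k m k' m' : ℕ)
        (ρB : Fin k → KZ.IntegralRep (n + 1)) (ρS : Fin m → KZ.IntegralRep (n + 1))
        (ρB' : Fin k' → KZ.IntegralRep (n + 1)) (ρS' : Fin m' → KZ.IntegralRep (n + 1))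
        (cB : Fin k → ℤ) (cS : Fin m → ℤ) (cB' : Fin k' → ℤ) (cS' : Fin m' → ℤ),
      (∀ x ∈ r.domain, r.integrand x = 1) → (∀ x ∈ r'.domain, r'.integrand x = 1) →
      (∀ i, ∀ x ∈ (ρB i).domain, (ρB i).integrand x = 1) →
      (∀ ν, ∀ x ∈ (ρS ν).domain, (ρS ν).integrand x = 1) →
      (∀ i, ∀ x ∈ (ρB' i).domain, (ρB' i).integrand x = 1) →
      (∀ ν, ∀ x ∈ (ρS' ν).domain, (ρS' ν).integrand x = 1) →
      (∀ i, cB i ≠ 0 → ∃ (v : ℝ) (hv : IsAlgebraic ℚ v),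
        KZ.of (ρB i) - KZ.of (KZ.IntegralRep.unit.constMul v hv) ∈ KZ.relations) →
      (∀ ν, cS ν ≠ 0 → ∃ (A : Matrix (Fin (n + 1)) (Fin (n + 1)) ℝ) (b : Fin (n + 1) → ℝ),
        (∀ j l, IsAlgebraic ℚ (A j l)) ∧ (∀ j, IsAlgebraic ℚ (b j)) ∧ A.det ≠ 0 ∧
        (ρS ν).domain = (fun x => A.mulVec x + b) ''
          {p : Fin (n + 1) → ℝ | (∀ j : Fin n, (fun _ => (1 : ℝ)) j < p (Fin.castSucc j) ∧
            p (Fin.castSucc j) < (fun _ => α) j) ∧ 0 < p (Fin.last n) ∧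
            p (Fin.last n) * ∏ j : Fin n, p (Fin.castSucc j) < 1}) →
      (∀ i, cB' i ≠ 0 → ∃ (v : ℝ) (hv : IsAlgebraic ℚ v),
        KZ.of (ρB' i) - KZ.of (KZ.IntegralRep.unit.constMul v hv) ∈ KZ.relations) →
      (∀ ν, cS' ν ≠ 0 → ∃ (A : Matrix (Fin (n + 1)) (Fin (n + 1)) ℝ) (b : Fin (n + 1) → ℝ),
        (∀ j l, IsAlgebraic ℚ (A j l)) ∧ (∀ j, IsAlgebraic ℚ (b j)) ∧ A.det ≠ 0 ∧
        (ρS' ν).domain = (fun x => A.mulVec x + b) ''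
          {p : Fin (n + 1) → ℝ | (∀ j : Fin n, (fun _ => (1 : ℝ)) j < p (Fin.castSucc j) ∧
            p (Fin.castSucc j) < (fun _ => α) j) ∧ 0 < p (Fin.last n) ∧
            p (Fin.last n) * ∏ j : Fin n, p (Fin.castSucc j) < 1}) →
      (∀ᵐ x : Fin (n + 1) → ℝ, r.domain.indicator (fun _ => (1 : ℝ)) x =
        ∑ i, (cB i : ℝ) * (ρB i).domain.indicator (fun _ => (1 : ℝ)) x +
          ∑ ν, (cS ν : ℝ) * (ρS ν).domain.indicator (fun _ => (1 : ℝ)) x) →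
      (∀ᵐ x : Fin (n + 1) → ℝ, r'.domain.indicator (fun _ => (1 : ℝ)) x =
        ∑ i, (cB' i : ℝ) * (ρB' i).domain.indicator (fun _ => (1 : ℝ)) x +
          ∑ ν, (cS' ν : ℝ) * (ρS' ν).domain.indicator (fun _ => (1 : ℝ)) x) →
      r.value = r'.value → KZ.Equivalent r r' := fun n hn α hα halg =>
  pointCellOrbitPairs (n + 1) _
    (lbc_isSemialgebraic_logBox (fun _ => isAlgebraic_one) (fun _ => halg))
    (by rw [tplb_volume_logBox n hα halg]; exact ENNReal.ofReal_ne_top)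
    (tplb_transcendental_volume_logBox n hn hα halg)

end Summit.KontsevichZagierPeriods.SymplecticScissors.LogPolytope

end
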